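import Mathlib
import HarnessLib
import Literature.Computability.QuantumComplexity.SignedForrelationGadget

/-!
# Bent-padding gadget: `Φ(padF f k, padG g k) = (1 + Φ(f,g))/2` for a self-dual bent `k`

Crux-ideate sketch (stmt-QuantumAdvantage-14830, ideator 2, idea `karp-pullback-unsigned-forrelation`).
Pure finite Fourier algebra next to `SignedForrelationGadget.lean`.
-/

noncomputable section

namespace Summit.QuantumAdvantage.QuantumAdvantage.Cruxes.SignedExactSliceIsLift.KarpPullback

open Finset
open Literature.Computability.QuantumComplexity
open Literature.Computability.QuantumComplexity.DerivativeWalsh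
open Literature.Computability.QuantumComplexity.SgnForrMem

variable {n : ℕ}

/-- `F(x,c₁,c₂) = (1 ⊕ c₁)·f(x) ⊕ c₁·(c₂ ⊕ k(x))` on `{0,1}^{n+2}` (coordinates `n`, `n+1` are the pads). -/
def padF (f k : (Fin n → Bool) → Bool) (X : Fin (n + 2) → Bool) : Bool :=
  xor (!(Fin.init X (Fin.last n)) && f (Fin.init (Fin.init X)))
    ((Fin.init X (Fin.last n)) && xor (X (Fin.last (n + 1))) (k (Fin.init (Fin.init X))))

/-- `G(y,d₁,d₂) = (1 ⊕ d₂)·g(y) ⊕ d₂·(k(y) ⊕ d₁)`. -/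
def padG (g k : (Fin n → Bool) → Bool) (Y : Fin (n + 2) → Bool) : Bool :=
  xor (!(Y (Fin.last (n + 1))) && g (Fin.init (Fin.init Y)))
    ((Y (Fin.last (n + 1))) && xor (k (Fin.init (Fin.init Y))) (Fin.init Y (Fin.last n)))

@[simp] theorem padF_snoc (f k : (Fin n → Bool) → Bool) (x : Fin n → Bool) (c₁ c₂ : Bool) :
    padF f k (Fin.snoc (Fin.snoc x c₁) c₂) = xor (!c₁ && f x) (c₁ && xor c₂ (k x)) := by
  simp [padF, Fin.init_snoc, Fin.snoc_last]

@[simp] theorem padG_snoc (g k : (Fin n → Bool) → Bool) (y : Fin n → Bool) (d₁ d₂ : Bool) :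
    padG g k (Fin.snoc (Fin.snoc y d₁) d₂) = xor (!d₂ && g y) (d₂ && xor (k y) d₁) := by
  simp [padG, Fin.init_snoc, Fin.snoc_last]

/-- The Walsh transform of the padded `F`: `W_F(y,d₁,0) = 2 W_f(y)`, `W_F(y,d₁,1) = 2 (-1)^{d₁} W_k(y)`. -/
theorem W_padF (f k : (Fin n → Bool) → Bool) (y : Fin n → Bool) (d₁ d₂ : Bool) :
    W (fun X => signOf (padF f k X)) (Fin.snoc (Fin.snoc y d₁) d₂) =
      if d₂ then 2 * signOf d₁ * W (fun x => signOf (k x)) y else 2 * W (fun x => signOf (f x)) y := by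
  unfold W
  rw [sum_snoc, sum_snoc]
  simp only [padF_snoc, twist_snoc, Fintype.sum_bool, Bool.not_true, Bool.not_false, Bool.true_and,
    Bool.false_and, Bool.and_true, Bool.and_false, Bool.xor_false, Bool.false_xor, Bool.true_xor,
    signOf_xor, mul_sum, ← sum_add_distrib]
  cases d₁ <;> cases d₂ <;> simp only [signOf_true, signOf_false, if_true, if_false, Bool.false_eq_true]
    <;> refine sum_congr rfl fun x _ => ?_ <;> cases f x <;> cases k x <;> simp [signOf] <;> ring

/-- The unnormalised padded forrelation sum: `∑_Y (-1)^{G(Y)} W_F(Y) = 4 ∑_y (-1)^{g y} W_f(y) + 4·2^n·√(2^n)`. -/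
theorem sum_padded (f g k : (Fin n → Bool) → Bool) (hk : IsSelfDualBent k) :
    ∑ Y, signOf (padG g k Y) * W (fun X => signOf (padF f k X)) Y =
      4 * ∑ y, signOf (g y) * W (fun x => signOf (f x)) y + 4 * Real.sqrt (2 ^ n) * 2 ^ n := by
  have hW : ∀ y, W (fun x => signOf (k x)) y = Real.sqrt (2 ^ n) * signOf (k y) := hk
  rw [sum_snoc, sum_snoc]
  simp only [padG_snoc, W_padF, Fintype.sum_bool, Bool.not_true, Bool.not_false, Bool.true_and,
    Bool.false_and, if_true, if_false, Bool.false_eq_true, signOf_xor, signOf_true, signOf_false, hW]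
  have hcard : (4 : ℝ) * Real.sqrt (2 ^ n) * 2 ^ n = ∑ _y : Fin n → Bool, 4 * Real.sqrt (2 ^ n) := by
    simp; ring
  rw [hcard, mul_sum, ← sum_add_distrib]
  refine sum_congr rfl fun y _ => ?_
  cases k y <;> cases g y <;> simp [signOf] <;> ring

/-- **The gadget identity**: for a self-dual bent `k`, `Φ(F, G) = (1 + Φ(f, g)) / 2`. -/
theorem forrelation_pad (f g k : (Fin n → Bool) → Bool) (hk : IsSelfDualBent k) :
    forrelation (padF f k) (padG g k) = (1 + forrelation f g) / 2 := by
  rw [forrelation_eq_sum_W, forrelation_eq_sum_W, sum_padded f g k hk]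
  have h3 : Real.sqrt ((2 : ℝ) ^ (3 * (n + 2))) = 8 * Real.sqrt (2 ^ (3 * n)) := by
    rw [show (3 * (n + 2)) = 3 * n + 6 by ring, pow_add, Real.sqrt_mul (by positivity),
      show ((2 : ℝ) ^ 6) = 8 ^ 2 by norm_num, Real.sqrt_sq (by norm_num)]
    ring
  have h1 : Real.sqrt ((2 : ℝ) ^ (3 * n)) = (2 : ℝ) ^ n * Real.sqrt (2 ^ n) := by
    rw [show (3 * n) = 2 * n + n by ring, pow_add, Real.sqrt_mul (by positivity),
      show ((2 : ℝ) ^ (2 * n)) = (2 ^ n) ^ 2 by rw [← pow_mul]; ring_nf, Real.sqrt_sq (by positivity)]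
  have hpos : (2 : ℝ) ^ n ≠ 0 := by positivity
  have hpos' : Real.sqrt ((2 : ℝ) ^ n) ≠ 0 := by positivity
  rw [h3, h1]
  field_simp
  ring

/-- With `ipHalf` (self-dual bent, landed): the concrete gadget on an even number of variables. -/
theorem forrelation_pad_ipHalf (t : ℕ) (f g : (Fin (t + t) → Bool) → Bool) :
    forrelation (padF f (ipHalf t)) (padG g (ipHalf t)) = (1 + forrelation f g) / 2 :=
  forrelation_pad f g (ipHalf t) (isSelfDualBent_ipHalf t)

end Summit.QuantumAdvantage.QuantumAdvantage.Cruxes.SignedExactSliceIsLift.KarpPullback
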